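import Summits.QuantumFields.BalabanUV.T4Continuum.Support.NE7FrameReadingSpikeLettersGeneral
import Summits.QuantumFields.BalabanUV.T4Continuum.Support.NE7TopNormalisedSpikeEnergyLetters
import Summits.QuantumFields.BalabanUV.T4Continuum.Support.NE7TopNormalisedQbarLetters
import HarnessLib

/-!
# Support | NE7 (gen 98, ROAD-Γ′ S2′ — THE SPIKE LETTERS IN THE BINDER'S ENERGY CURRENCY WITHOUT A TRIVIAL TOP FRAME): the corner spikes `S := gaugeDir W (spikeW M (framePotW L (j+1) W X))`
# obey `‖S‖_w ≤ 2√((#Plane + d)·(3Θ₂ + A₂′(Mb)²))·‖X‖_w` and `x·Σ_{perWin}‖curl_W S‖ ≤ 2·#Plane·(Θ₁ + A₁)·(M²x)²·‖X‖_w²`, where `Θ₂, Θ₁` are the FRAME MASSES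
# (`Σ_z‖log v_{j+1}(z)‖² ≤ Θ₂·M²·‖X‖_w²`, `Σ_z‖log v_{j+1}(z)‖ ≤ Θ₁·M²·‖X‖_w²`) — gen 98's `NE7TopNormalisedSpikeEnergyLetters` with `log v ≡ 0` replaced by the frame masses

Cell `pub-balaban`, rung (B)+1 sub-cell t4, lineage `b2b-balaban-t4-ne7-p1` (CRUX PROVER NE7 #1 = OWNER of row NE7), generation 98; memo `t4/b2b-balaban-t4-ne7-p1-g98/ROAD-G98.md` §2.8.
Over `NE7FrameReadingSpikeLettersGeneral.dirSq_curlSq_spikes_le ∕ sum_norm_curl_spikes_le` (this gen: the raw spike letters with additive frame masses) and the bookkeeping of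
`NE7TopNormalisedSpikeEnergyLetters` (`energyNormW_le_of_sq_le`, `sq_mul_le_sq_of_one_le`) + `NE7TopNormalisedQbarLetters.inv_sq_mul_l2sq_le_energySq`.

WHY (memo §2.8).  Under the repaired top normalisation S2′ (corner rotation by the inverse frame; `hdbar` without `log v ≡ 0`) the frame part carried by the spikes has corner masses bounded by
the frame masses `Θ₂, Θ₁` of the representative plus gen 97's defect letters; THIS FILE is the energy-currency conversion (ceilings `Γ₁…Γ₄` as before, `A₂′ = 12288d³L⁵Γ₁ + 3072dLK²Γ₂`,
`A₁ = 16dL(6Γ₁+2Γ₄) + K₁Γ₃`).  With `Θ₂ = Θ₁ = 0` it is p742464 up to the constant `3∕2`.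
WHAT ([folklore]; 0 def, 0 sorry).  **`energyNormW_spikes_le_of_frameMass`**, **`curlL1_spikes_le_of_frameMass`**.
HONEST FRAMING (page 1): composition and real arithmetic over landed kernel theorems; nothing of Bałaban's asserted; S2′, the frame masses, `hdecomp♭` and NE7 are NOT proved; spine 0∕9; finite T⁴
rung (B)+1 — NOT infinite volume, NOT mass gap, NOT `BetaPertH`, NOT Clay.  Continuum YM on T⁴ ⇐ BetaPertH ∧ nine spine estimates (0/9 proved); BetaPertH ⇐ (D1) ∧ (D4) ∧ CAP+tail; G-an2-4
gates asym, D1 and NE2/3/4.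
-/

set_option autoImplicit false

open scoped BigOperators Matrix Matrix.Norms.L2Operator
open NormedSpace Finset

namespace Summit.QuantumFields.BalabanUV.T4Continuum.NE7DbarSpikeEnergyLetters

open Literature.MathematicalPhysics.QuantumFieldTheory.Balaban1983to89
open B7Prop1Explicit B7Prop2Explicit B7Prop3Flat MatrixLog
open T4AveragingDeficitWall (Ad IsUnitaryCfg IsSkewDir SmallField vary curl dirL1 dirSq curlSq)
open T4AveragingDeficitWallBoundary (IsPeriodicCfg periodBox)
open AveragingDeficitPeriodicCounting (IsPeriodicDir)
open AveragingDeficitMultiLevelPrep (cavgIter LevelSmall tower)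
open B7Eq92Concrete (vcov)
open NE3TangentCovariantTower (dirIter QbarIter framePotW)
open NE3CovariantLineSumsL2 (l2sq l2sq_nonneg)
open NE3.PairLandauB8Avg (relPert)
open ReplicationRightInverseBound (radSum)
open BlockAverageVaryHolo (nbRad)
open NE3CovariantLineSumsError (Csup)
open ShellMeasureAverageProp4General (C1cov C1cov_pos)
open BlockAveragePushDirGauge (gaugeDir)
open NE3CornerSpikes (spikeW)
open NE3EnergyWeightedShapes (energyNormW energyNormW_nonneg)
open NE3ProductPathBounds (energySq_nonneg)
open NE3EnergyHessContTwoTerm (curlSq_nonneg dirSq_nonneg)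
open MinimalActionLevels (perWin)
open NE7FrameReadingSpikeLettersGeneral (dirSq_curlSq_spikes_le sum_norm_curl_spikes_le)
open NE7TopNormalisedSpikeEnergyLetters (energyNormW_le_of_sq_le sq_mul_le_sq_of_one_le)
open NE7TopNormalisedQbarLetters (inv_sq_mul_l2sq_le_energySq)

noncomputable section

variable {d : ℕ} {n : Type*} [Fintype n] [DecidableEq n]

/-! ## §1 The spike letters in the binder's energy currency, with frame masses -/

/-- **THE ν-LETTER OF THE SPIKES** (regime of `NE7TopFrameReadingSpikeLetters.dirSq_curlSq_spikes_le_of_top`; `M = L^{j+1}`, `M²x ≤ 1`, geometric-sum ceilings `Γ₁`, `Γ₂`):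
`‖gaugeDir W (spikeW M (framePotW L (j+1) W X))‖_w ≤ 2√((#Plane + d)·A₂)·(M·b)·‖X‖_w`, `A₂ = 8192d³L⁵Γ₁ + 2048dL·K²Γ₂`, `K = C1cov·L²√(d(4L+1)^d)`. [folklore] -/
theorem energyNormW_spikes_le_of_frameMass [Nonempty n] {L N : ℕ} [NeZero N] (hL : 2 ≤ L) (hN : 1 ≤ N) (j : ℕ)
    {W : Site d → Fin d → (Matrix n n ℂ)ˣ} {x : ℝ} (hWu : IsUnitaryCfg W) (hWP : IsPeriodicCfg W ((N * L ^ (j + 1) : ℕ) : ℤ))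
    (hx : 0 ≤ x) (hsm : LevelSmall d L j x) (hWx : SmallField W x) (hε : ((L : ℝ) ^ (j + 1)) ^ 2 * x ≤ 1)
    {α₀ b : ℝ} (hα : 0 < α₀) (hα3 : C0 d * (2 * α₀) ≤ 1 / 3) (hα4 : 4 * (2 * α₀) ≤ c2' d L)
    (h52 : pdev W < α₀ * (((L : ℝ) ^ (j + 1))⁻¹) ^ 2) (hb : 0 ≤ b)
    {X : Site d → Fin d → Matrix n n ℂ} (hX : ∀ (y : Site d) (κ : Fin d), ‖X y κ‖ ≤ b) (hXP : IsPeriodicDir X ((N * L ^ (j + 1) : ℕ) : ℤ))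
    (hsmall : Real.exp (4 * (800 * ((d : ℝ) + 1) ^ 2 * ((d : ℝ) + 4)) * α₀)
      * (1 + 8 * (131072 * ((d : ℝ) + 1) ^ 2) * ((L : ℝ) ^ (j + 1) * b)) ≤ 2)
    (hc₃ : 4 * ((L : ℝ) ^ (j + 1) * b) ≤ c3 d L)
    (hK : 16 * (C1cov d * (L : ℝ) ^ 2 * Real.sqrt (d * (2 * (2 * L) + 1) ^ d)) * (L : ℝ) ^ (j + 1) * b ≤ Real.sqrt ((L : ℝ) ^ 2 / (L : ℝ) ^ d))
    (h44 : 44 * ((d : ℝ) * L * ((L : ℝ) ^ (j + 1) * b)) ≤ 1)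
    {Θ₂ : ℝ} (hΘ₂0 : 0 ≤ Θ₂) (hΘ₂ : ∑ z ∈ periodBox (d := d) N, ‖mlog ((vcov L W (relPert W X) (j + 1) z : (Matrix n n ℂ)ˣ) : Matrix n n ℂ)‖ ^ 2
      ≤ Θ₂ * ((L : ℝ) ^ (j + 1)) ^ 2 * energyNormW L (j + 1) W X (periodBox (d := d) (N * L ^ (j + 1))) ^ 2)
    {Γ₁ Γ₂ : ℝ} (hΓ₁ : ∑ m ∈ range (j + 1), (L : ℝ) ^ m * ((L : ℝ) ^ 2 / (L : ℝ) ^ d) ^ m ≤ Γ₁)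
    (hΓ₂ : ((j : ℝ) + 1) * ∑ i ∈ range j, ((L : ℝ) ^ 2 * ((L : ℝ) ^ 2 / (L : ℝ) ^ d)) ^ i ≤ Γ₂ * ((L : ℝ) ^ (j + 1)) ^ 2) :
    energyNormW L (j + 1) W (gaugeDir W (spikeW (L ^ (j + 1)) (framePotW L (j + 1) W X))) (periodBox (d := d) (N * L ^ (j + 1)))
      ≤ 2 * Real.sqrt (((Fintype.card (T4AveragingDeficitWall.Plane d) : ℝ) + d)
            * (3 * Θ₂ + (12288 * ((d : ℝ) ^ 3 * (L : ℝ) ^ 5) * Γ₁ + 3072 * ((d : ℝ) * L) * (C1cov d * (L : ℝ) ^ 2 * Real.sqrt (d * (2 * (2 * L) + 1) ^ d)) ^ 2 * Γ₂)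
              * ((L : ℝ) ^ (j + 1) * b) ^ 2))
          * energyNormW L (j + 1) W X (periodBox (d := d) (N * L ^ (j + 1))) := by
  have hL0 : (0 : ℝ) < L := by exact_mod_cast (show 0 < L by omega)
  -- the spike letters, fetched BEFORE the abbreviations so that `set` rewrites them
  have hsp := dirSq_curlSq_spikes_le hL hN j hWu hWP hx hsm hWx hα hα3 hα4 h52 hb hX hXP hsmall hc₃ hK h44
  rw [show L ^ (j + 1) * N = N * L ^ (j + 1) from Nat.mul_comm _ _] at hsp
  set M : ℝ := (L : ℝ) ^ (j + 1) with hMdef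
  have hM0 : 0 < M := by positivity
  have hM1 : 1 ≤ M := one_le_pow₀ (by exact_mod_cast (show 1 ≤ L by omega))
  set K : ℝ := C1cov d * (L : ℝ) ^ 2 * Real.sqrt (d * (2 * (2 * L) + 1) ^ d) with hKdef
  have hK0 : 0 ≤ K := by rw [hKdef]; have := C1cov_pos d; positivity
  set P : ℝ := (Fintype.card (T4AveragingDeficitWall.Plane d) : ℝ) with hPdef
  have hP0 : 0 ≤ P := by rw [hPdef]; positivity
  set F := periodBox (d := d) (N * L ^ (j + 1)) with hF
  set l2 : ℝ := l2sq F X with hl2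
  have hl20 : 0 ≤ l2 := l2sq_nonneg _ _
  set E : ℝ := energyNormW L (j + 1) W X F with hE
  have hE0 : 0 ≤ E := energyNormW_nonneg _ _ _ _ _
  set G₁ : ℝ := ∑ m ∈ range (j + 1), (L : ℝ) ^ m * ((L : ℝ) ^ 2 / (L : ℝ) ^ d) ^ m with hG₁
  set G₂ : ℝ := ∑ i ∈ range j, ((L : ℝ) ^ 2 * ((L : ℝ) ^ 2 / (L : ℝ) ^ d)) ^ i with hG₂
  have hG₁0 : 0 ≤ G₁ := by rw [hG₁]; exact Finset.sum_nonneg fun _ _ => by positivity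
  have hG₂0 : 0 ≤ G₂ := by rw [hG₂]; exact Finset.sum_nonneg fun _ _ => by positivity
  have hΓ₁0 : 0 ≤ Γ₁ := hG₁0.trans hΓ₁
  have hΓ₂0 : 0 ≤ Γ₂ := by
    have h : 0 * M ^ 2 ≤ Γ₂ * M ^ 2 := by rw [zero_mul]; exact le_trans (by positivity) hΓ₂
    exact le_of_mul_le_mul_right h (by positivity)
  obtain ⟨hdir, hcurl⟩ := hsp
  set T₂ : ℝ := 3 * (∑ z ∈ periodBox (d := d) N, ‖mlog ((vcov L W (relPert W X) (j + 1) z : (Matrix n n ℂ)ˣ) : Matrix n n ℂ)‖ ^ 2)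
      + 3 * (4096 * ((d : ℝ) ^ 3 * (L : ℝ) ^ 5) * b ^ 2 * M * G₁ * l2)
      + 3 * (((j : ℝ) + 1) * (((d : ℝ) * L) * (1024 * K ^ 2 * b ^ 2 * G₂ * l2))) with hT₂
  have hdir' : dirSq (gaugeDir W (spikeW (L ^ (j + 1)) (framePotW L (j + 1) W X))) F ≤ 4 * (d : ℝ) * T₂ := hdir
  have hcurl' : curlSq W (gaugeDir W (spikeW (L ^ (j + 1)) (framePotW L (j + 1) W X))) F ≤ 4 * x ^ 2 * P * T₂ := hcurl
  -- `T₂ ≤ (3Θ₂ + A₂′·(Mb)²)·M²·E²`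
  set A₂ : ℝ := 12288 * ((d : ℝ) ^ 3 * (L : ℝ) ^ 5) * Γ₁ + 3072 * ((d : ℝ) * L) * K ^ 2 * Γ₂ with hA₂
  have hA₂0 : 0 ≤ A₂ := by rw [hA₂]; positivity
  have hMM : M ≤ M * M := le_mul_of_one_le_left hM0.le hM1
  -- `l2 ≤ M²·E²`
  have hl2E : l2 ≤ M ^ 2 * E ^ 2 := by
    have h := inv_sq_mul_l2sq_le_energySq L j W X F
    have hM2 : 0 < M ^ 2 := by positivity
    have e : l2 = M ^ 2 * ((M ^ 2)⁻¹ * l2) := by field_simp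
    rw [e]; exact mul_le_mul_of_nonneg_left h hM2.le
  have hT₂le : T₂ ≤ (3 * Θ₂ + A₂ * (M * b) ^ 2) * (M ^ 2 * E ^ 2) := by
    have h1 : 3 * (4096 * ((d : ℝ) ^ 3 * (L : ℝ) ^ 5) * b ^ 2 * M * G₁ * l2) ≤ 12288 * ((d : ℝ) ^ 3 * (L : ℝ) ^ 5) * Γ₁ * (M * b) ^ 2 * l2 := by
      have e : 3 * (4096 * ((d : ℝ) ^ 3 * (L : ℝ) ^ 5) * b ^ 2 * M * G₁ * l2) = 12288 * ((d : ℝ) ^ 3 * (L : ℝ) ^ 5) * G₁ * M * (b ^ 2 * l2) := by ring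
      have e' : 12288 * ((d : ℝ) ^ 3 * (L : ℝ) ^ 5) * Γ₁ * (M * b) ^ 2 * l2 = 12288 * ((d : ℝ) ^ 3 * (L : ℝ) ^ 5) * Γ₁ * (M * M) * (b ^ 2 * l2) := by ring
      rw [e, e']
      calc 12288 * ((d : ℝ) ^ 3 * (L : ℝ) ^ 5) * G₁ * M * (b ^ 2 * l2) ≤ 12288 * ((d : ℝ) ^ 3 * (L : ℝ) ^ 5) * Γ₁ * M * (b ^ 2 * l2) := by gcongr
        _ ≤ 12288 * ((d : ℝ) ^ 3 * (L : ℝ) ^ 5) * Γ₁ * (M * M) * (b ^ 2 * l2) := by gcongr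
    have h2 : 3 * (((j : ℝ) + 1) * (((d : ℝ) * L) * (1024 * K ^ 2 * b ^ 2 * G₂ * l2))) ≤ 3072 * ((d : ℝ) * L) * K ^ 2 * Γ₂ * (M * b) ^ 2 * l2 := by
      have e : 3 * (((j : ℝ) + 1) * (((d : ℝ) * L) * (1024 * K ^ 2 * b ^ 2 * G₂ * l2)))
          = 3072 * ((d : ℝ) * L) * K ^ 2 * (((j : ℝ) + 1) * G₂) * (b ^ 2 * l2) := by ring
      have e' : 3072 * ((d : ℝ) * L) * K ^ 2 * Γ₂ * (M * b) ^ 2 * l2 = 3072 * ((d : ℝ) * L) * K ^ 2 * (Γ₂ * M ^ 2) * (b ^ 2 * l2) := by ring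
      rw [e, e']
      gcongr
    have h3 : 12288 * ((d : ℝ) ^ 3 * (L : ℝ) ^ 5) * Γ₁ * (M * b) ^ 2 * l2 + 3072 * ((d : ℝ) * L) * K ^ 2 * Γ₂ * (M * b) ^ 2 * l2
        = A₂ * (M * b) ^ 2 * l2 := by rw [hA₂]; ring
    have h4 : A₂ * (M * b) ^ 2 * l2 ≤ A₂ * (M * b) ^ 2 * (M ^ 2 * E ^ 2) := mul_le_mul_of_nonneg_left hl2E (by positivity)
    rw [hT₂]
    linarith [hΘ₂, h1, h2, h3, h4]
  set Q : ℝ := 3 * Θ₂ + A₂ * (M * b) ^ 2 with hQ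
  have hQ0 : 0 ≤ Q := by rw [hQ]; positivity
  clear_value Q
  have hQE : 0 ≤ Q * E ^ 2 := mul_nonneg hQ0 (sq_nonneg _)
  have hPQE : 0 ≤ P * (Q * E ^ 2) := mul_nonneg hP0 hQE
  -- the weighted energy square
  have hx2 : x ^ 2 * M ^ 2 ≤ 1 := by
    have h := sq_mul_le_sq_of_one_le (x := x) hM1
    have h0 : 0 ≤ M ^ 2 * x := by positivity
    have h1 : (M ^ 2 * x) ^ 2 ≤ 1 := by
      calc (M ^ 2 * x) ^ 2 = (M ^ 2 * x) * (M ^ 2 * x) := sq _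
        _ ≤ 1 * 1 := mul_le_mul hε hε h0 zero_le_one
        _ = 1 := one_mul _
    exact h.trans h1
  set c : ℝ := 2 * Real.sqrt ((P + d) * Q) * E with hc
  have hc0 : 0 ≤ c := by rw [hc]; exact mul_nonneg (mul_nonneg (by norm_num) (Real.sqrt_nonneg _)) hE0
  refine energyNormW_le_of_sq_le L j W _ F hc0 ?_
  have hPdQ : 0 ≤ (P + d) * Q := mul_nonneg (by positivity) hQ0
  have hsq : Real.sqrt ((P + d) * Q) ^ 2 = (P + d) * Q := Real.sq_sqrt hPdQ
  have e : c ^ 2 = 4 * ((P + d) * Q) * E ^ 2 := by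
    rw [hc]
    calc (2 * Real.sqrt ((P + d) * Q) * E) ^ 2 = 4 * Real.sqrt ((P + d) * Q) ^ 2 * E ^ 2 := by ring
      _ = 4 * ((P + d) * Q) * E ^ 2 := by rw [hsq]
  rw [e]
  have hMinv : (M⁻¹) ^ 2 * (M ^ 2 * E ^ 2) = E ^ 2 := by field_simp
  calc curlSq W (gaugeDir W (spikeW (L ^ (j + 1)) (framePotW L (j + 1) W X))) F
        + (M⁻¹) ^ 2 * dirSq (gaugeDir W (spikeW (L ^ (j + 1)) (framePotW L (j + 1) W X))) F
      ≤ 4 * x ^ 2 * P * T₂ + (M⁻¹) ^ 2 * (4 * (d : ℝ) * T₂) := add_le_add hcurl' (mul_le_mul_of_nonneg_left hdir' (by positivity))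
    _ ≤ 4 * x ^ 2 * P * (Q * (M ^ 2 * E ^ 2)) + (M⁻¹) ^ 2 * (4 * (d : ℝ) * (Q * (M ^ 2 * E ^ 2))) :=
        add_le_add (mul_le_mul_of_nonneg_left hT₂le (by positivity)) (mul_le_mul_of_nonneg_left (mul_le_mul_of_nonneg_left hT₂le (by positivity)) (by positivity))
    _ = 4 * (x ^ 2 * M ^ 2) * P * (Q * E ^ 2) + 4 * (d : ℝ) * (Q * ((M⁻¹) ^ 2 * (M ^ 2 * E ^ 2))) := by ring
    _ = 4 * (x ^ 2 * M ^ 2) * P * (Q * E ^ 2) + 4 * (d : ℝ) * (Q * E ^ 2) := by rw [hMinv]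
    _ ≤ 4 * 1 * P * (Q * E ^ 2) + 4 * (d : ℝ) * (Q * E ^ 2) := by
        have h := mul_le_mul_of_nonneg_right hx2 hPQE
        linarith
    _ = 4 * ((P + d) * Q) * E ^ 2 := by ring

/-- **THE κ-LETTER OF THE SPIKES** (regime of `NE7TopFrameReadingSpikeLetters.sum_norm_curl_spikes_le_of_top`; geometric-sum ceilings `Γ₁`, `Γ₃`, `Γ₄`):
`x·Σ_{p∈perWin(N·M)}‖curl_W (gaugeDir W (spikeW M f)) p‖ ≤ 2·#Plane·A₁·(M²x)²·‖X‖_w²`, `A₁ = 16dL(6Γ₁ + 2Γ₄) + K₁Γ₃`, `K₁ = 64C1cov·L²d(4L+1)^d`. [folklore] -/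
theorem curlL1_spikes_le_of_frameMass [Nonempty n] {L N : ℕ} (hL : 2 ≤ L) (hN : 1 ≤ N) (j : ℕ)
    {W : Site d → Fin d → (Matrix n n ℂ)ˣ} {x : ℝ} (hWu : IsUnitaryCfg W) (hWP : IsPeriodicCfg W ((N * L ^ (j + 1) : ℕ) : ℤ))
    (hx : 0 ≤ x) (hsm : LevelSmall d L j x) (hWx : SmallField W x)
    {α₀ b : ℝ} (hα : 0 < α₀) (hα3 : C0 d * (2 * α₀) ≤ 1 / 3) (hα4 : 4 * (2 * α₀) ≤ c2' d L)
    (h52 : pdev W < α₀ * (((L : ℝ) ^ (j + 1))⁻¹) ^ 2) (hb : 0 ≤ b)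
    {X : Site d → Fin d → Matrix n n ℂ} (hX : ∀ (y : Site d) (κ : Fin d), ‖X y κ‖ ≤ b) (hXP : IsPeriodicDir X ((N * L ^ (j + 1) : ℕ) : ℤ))
    (hsmall : Real.exp (4 * (800 * ((d : ℝ) + 1) ^ 2 * ((d : ℝ) + 4)) * α₀)
      * (1 + 8 * (131072 * ((d : ℝ) + 1) ^ 2) * ((L : ℝ) ^ (j + 1) * b)) ≤ 2)
    (hc₃ : 4 * ((L : ℝ) ^ (j + 1) * b) ≤ c3 d L)
    (hK : 16 * (C1cov d * (L : ℝ) ^ 2 * Real.sqrt (d * (2 * (2 * L) + 1) ^ d)) * (L : ℝ) ^ (j + 1) * b ≤ Real.sqrt ((L : ℝ) ^ 2 / (L : ℝ) ^ d))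
    (hS1 : (16 * (d + 1) * (d + 4) * (L : ℝ) ^ 2 * Csup d L * (d * (2 * nbRad d L + 1) ^ d)) * radSum d L j x ≤ ((L : ℝ) / (L : ℝ) ^ d) / 2)
    (h44 : 44 * ((d : ℝ) * L * ((L : ℝ) ^ (j + 1) * b)) ≤ 1)
    {Θ₁ : ℝ} (hΘ₁0 : 0 ≤ Θ₁) (hΘ₁ : ∑ z ∈ periodBox (d := d) N, ‖mlog ((vcov L W (relPert W X) (j + 1) z : (Matrix n n ℂ)ˣ) : Matrix n n ℂ)‖
      ≤ Θ₁ * ((L : ℝ) ^ (j + 1)) ^ 2 * energyNormW L (j + 1) W X (periodBox (d := d) (N * L ^ (j + 1))) ^ 2)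
    {Γ₁ Γ₃ Γ₄ : ℝ} (hΓ₁ : ∑ m ∈ range (j + 1), (L : ℝ) ^ m * ((L : ℝ) ^ 2 / (L : ℝ) ^ d) ^ m ≤ Γ₁)
    (hΓ₃ : ∑ i ∈ range j, (((L : ℝ) / (L : ℝ) ^ d) * L) ^ i ≤ Γ₃) (hΓ₄ : ∑ m ∈ range (j + 1), ((L : ℝ) ^ 2 / (L : ℝ) ^ d) ^ m ≤ Γ₄) :
    x * ∑ p ∈ perWin d (N * L ^ (j + 1)), ‖curl W (gaugeDir W (spikeW (L ^ (j + 1)) (framePotW L (j + 1) W X))) p‖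
      ≤ 2 * (Fintype.card (T4AveragingDeficitWall.Plane d) : ℝ)
          * (Θ₁ + (16 * ((d : ℝ) * L) * (6 * Γ₁ + 2 * Γ₄) + 64 * (C1cov d * (L : ℝ) ^ 2 * (d * (2 * (2 * (L : ℝ)) + 1) ^ d)) * Γ₃))
          * (((L : ℝ) ^ (j + 1)) ^ 2 * x) ^ 2 * energyNormW L (j + 1) W X (periodBox (d := d) (N * L ^ (j + 1))) ^ 2 := by
  have hL0 : (0 : ℝ) < L := by exact_mod_cast (show 0 < L by omega)
  have hsp := sum_norm_curl_spikes_le hL hN j hWu hWP hx hsm hWx hα hα3 hα4 h52 hb hX hXP hsmall hc₃ hK hS1 h44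
  rw [show L ^ (j + 1) * N = N * L ^ (j + 1) from Nat.mul_comm _ _] at hsp
  set M : ℝ := (L : ℝ) ^ (j + 1) with hMdef
  have hM0 : 0 < M := by positivity
  have hM1 : 1 ≤ M := one_le_pow₀ (by exact_mod_cast (show 1 ≤ L by omega))
  set K₁ : ℝ := 64 * (C1cov d * (L : ℝ) ^ 2 * (d * (2 * (2 * (L : ℝ)) + 1) ^ d)) with hK₁
  have hK₁0 : 0 ≤ K₁ := by rw [hK₁]; have := C1cov_pos d; positivity
  set P : ℝ := (Fintype.card (T4AveragingDeficitWall.Plane d) : ℝ) with hPdef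
  have hP0 : 0 ≤ P := by rw [hPdef]; positivity
  set F := periodBox (d := d) (N * L ^ (j + 1)) with hF
  set l2 : ℝ := l2sq F X with hl2
  have hl20 : 0 ≤ l2 := l2sq_nonneg _ _
  set E : ℝ := energyNormW L (j + 1) W X F with hE
  have hE0 : 0 ≤ E := energyNormW_nonneg _ _ _ _ _
  set G₁ : ℝ := ∑ m ∈ range (j + 1), (L : ℝ) ^ m * ((L : ℝ) ^ 2 / (L : ℝ) ^ d) ^ m with hG₁
  set G₃ : ℝ := ∑ i ∈ range j, (((L : ℝ) / (L : ℝ) ^ d) * L) ^ i with hG₃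
  set G₄ : ℝ := ∑ m ∈ range (j + 1), ((L : ℝ) ^ 2 / (L : ℝ) ^ d) ^ m with hG₄
  have hG₁0 : 0 ≤ G₁ := by rw [hG₁]; exact Finset.sum_nonneg fun _ _ => by positivity
  have hG₃0 : 0 ≤ G₃ := by rw [hG₃]; exact Finset.sum_nonneg fun _ _ => by positivity
  have hG₄0 : 0 ≤ G₄ := by rw [hG₄]; exact Finset.sum_nonneg fun _ _ => by positivity
  have hΓ₁0 : 0 ≤ Γ₁ := hG₁0.trans hΓ₁
  have hΓ₃0 : 0 ≤ Γ₃ := hG₃0.trans hΓ₃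
  have hΓ₄0 : 0 ≤ Γ₄ := hG₄0.trans hΓ₄
  set Fm : ℝ := ∑ z ∈ periodBox (d := d) N, ‖mlog ((vcov L W (relPert W X) (j + 1) z : (Matrix n n ℂ)ˣ) : Matrix n n ℂ)‖ with hFm
  have hFm0 : 0 ≤ Fm := by rw [hFm]; exact Finset.sum_nonneg fun _ _ => norm_nonneg _
  set T₁ : ℝ := Fm + 16 * ((d : ℝ) * L) * (6 * G₁ + 2 * G₄) * l2 + K₁ * G₃ * l2 with hT₁
  set A₁ : ℝ := 16 * ((d : ℝ) * L) * (6 * Γ₁ + 2 * Γ₄) + K₁ * Γ₃ with hA₁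
  have hA₁0 : 0 ≤ A₁ := by rw [hA₁]; positivity
  have hl2E : l2 ≤ M ^ 2 * E ^ 2 := by
    have h := inv_sq_mul_l2sq_le_energySq L j W X F
    have hM2 : 0 < M ^ 2 := by positivity
    have e : l2 = M ^ 2 * ((M ^ 2)⁻¹ * l2) := by field_simp
    rw [e]; exact mul_le_mul_of_nonneg_left h hM2.le
  have hT₁le : T₁ ≤ (Θ₁ + A₁) * (M ^ 2 * E ^ 2) := by
    have h1 : 16 * ((d : ℝ) * L) * (6 * G₁ + 2 * G₄) * l2 ≤ 16 * ((d : ℝ) * L) * (6 * Γ₁ + 2 * Γ₄) * l2 := by gcongr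
    have h2 : K₁ * G₃ * l2 ≤ K₁ * Γ₃ * l2 := by gcongr
    have h3 : 16 * ((d : ℝ) * L) * (6 * Γ₁ + 2 * Γ₄) * l2 + K₁ * Γ₃ * l2 = A₁ * l2 := by rw [hA₁]; ring
    have h4 : A₁ * l2 ≤ A₁ * (M ^ 2 * E ^ 2) := mul_le_mul_of_nonneg_left hl2E hA₁0
    rw [hT₁]
    linarith [hΘ₁, h1, h2, h3, h4]
  have hx2 : x ^ 2 * M ^ 2 ≤ (M ^ 2 * x) ^ 2 := sq_mul_le_sq_of_one_le hM1
  calc x * ∑ p ∈ perWin d (N * L ^ (j + 1)), ‖curl W (gaugeDir W (spikeW (L ^ (j + 1)) (framePotW L (j + 1) W X))) p‖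
      ≤ x * (2 * x * P * T₁) := mul_le_mul_of_nonneg_left hsp hx
    _ ≤ x * (2 * x * P * ((Θ₁ + A₁) * (M ^ 2 * E ^ 2))) := by gcongr
    _ = 2 * P * (Θ₁ + A₁) * (x ^ 2 * M ^ 2) * E ^ 2 := by ring
    _ ≤ 2 * P * (Θ₁ + A₁) * (M ^ 2 * x) ^ 2 * E ^ 2 := by
        have hPA : 0 ≤ 2 * P * (Θ₁ + A₁) := by positivity
        have h1 : 0 ≤ E ^ 2 := sq_nonneg _
        exact mul_le_mul_of_nonneg_right (mul_le_mul_of_nonneg_left hx2 hPA) h1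

end

end Summit.QuantumFields.BalabanUV.T4Continuum.NE7DbarSpikeEnergyLetters
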